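import Mathlib.Analysis.Complex.CauchyIntegral
import Mathlib.Analysis.Complex.ExponentialBounds
import Literature.Analysis.Complex.TuranFirstMainTheorem
import Literature.Analysis.Complex.CartanLemma
import HarnessLib

/-!
# Turán's second main theorem on power sums (Turán 1951, via Cartan's lemma)

Topic `Literature/Analysis/Complex`, sub-namespace `PowerSum`. Everything in this file is PROVED.

**Turán's second main theorem** (pure power sums with nonnegative weights). Let `z_j ∈ ℂ`
(`j ∈ s`, `n = #s ≥ 1`, repetitions allowed), `b_j ≥ 0`, and let `j₀ ∈ s` carry a node of maximal
modulus, `|z_j| ≤ |z_{j₀}|` for all `j`. Then for every integer `D ≥ 0` there is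
`ν ∈ [D + 1, D + n]` with

  `|∑_j b_j z_j^ν| ≥ b_{j₀} · e⁻ⁿ (n / (250 (D + n)))^{n+1} · |z_{j₀}|^ν`

(`PowerSum.exists_powerSum_ge_max`). This is Turán's theorem with the normalisation by the
MAXIMAL modulus (P. Turán, *On a New Method…*, Wiley 1984, §8, with constant
`(n/(8e(m + n)))ⁿ`; the special case `b ≡ 1` with constant `(L/(A(D+L)))^L` is Lemma III of
Turán's 1951 paper on Carlson's theorem); only the shape `(n/(C(D+n)))^{O(n)}` of the constant
matters for the power-sum method, and that is what we prove.

## The proof (Turán 1951, Lemma III; reproduced in Cheng–Hassani–Fox, arXiv:1010.3371, §6)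

Normalise `|z_{j₀}| = 1` and put `H = n/(10(D+n))`. By Cartan's lemma on circles
(`Literature.Analysis.Complex.Cartan.exists_radius_prod_ge`) there is `r ∈ [1 − 5H, 1 − H/2]`
with `∏_j |w − z_j| ≥ μ := n!(H/n)ⁿ` on `|w| = r`; in particular no node lies on that circle, and
every sub-product of `∏ |w − z_j|` is `≥ μ/2ⁿ` there. Split the nodes into the LARGE ones
(`|z_j| > r`, among them `z_{j₀}`) and the SMALL ones (`|z_j| < r`, say `k` of them).
* If there is no small node, the first main theorem
  (`Literature.Analysis.Complex.PowerSum.exists_powerSum_ge`) with `ρ = r ≥ 1 − 5H` gives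
  `|S_ν| ≥ r^ν (∑ b_j)/(2ⁿC(D+n+1, n+1)) ≥ b_{j₀} e⁻ⁿ/(2ⁿ C(D+n+1,n+1))`.
* Otherwise let `P(w) = ∏_{small} (w − z_j)`, `G(w) = 1/(w^{D+1}P(w))`, enumerate the large nodes
  `x_0, …, x_{l−1}` and let `Q` be the NEWTON interpolant of `−G`… precisely
  `Q(w) = −∑_{t<l} β_t ∏_{t'<t}(w − x_{t'})` with
  `β_t = (2πi)⁻¹ ∮_{|u|=1/r} u^{D+k+t} du / (P*(u) Ω_{t+1}(u))`, `P*(u) = ∏_{small}(1 − z_j u)`,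
  `Ω_{t+1}(u) = ∏_{t'≤t}(1 − x_{t'}u)` (the divided differences of `G` written, after `z = 1/u`, as
  integrals over the circle `|u| = 1/r`, inside which `P*` has no zero). A telescoping identity and
  Cauchy's integral formula at `u = 1/x_τ` give `Q(x_τ) = 1/(x_τ^{D+1}P(x_τ))`, so
  `R = X^{D+1} P Q` (degree `≤ D + n`, no terms below `X^{D+1}`) is `1` at large and `0` at small
  nodes, whence `∑_{ν=D+1}^{D+n} [X^ν]R · S_ν = ∑_{large} b_j ≥ b_{j₀}`. On `|u| = 1/r` Cartan's
  bound gives `|β_t| ≤ r^{−D} 2ⁿ/μ`, so the coefficient `ℓ¹`-norm of `R` is `≤ 8ⁿ r^{−D}/μ` and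
  `max_ν |S_ν| ≥ b_{j₀} μ r^D/8ⁿ ≥ b_{j₀} e⁻ⁿ n!(H/n)ⁿ/8ⁿ`.
Both cases are `≥ b_{j₀} e⁻ⁿ (n/(250(D+n)))^{n+1}`.

## References

* P. Turán, *On Carlson's theorem in the theory of the zeta-function of Riemann*, Acta Math. Acad.
  Sci. Hungar. 2 (1951) 39–73, Lemma III (pp. 48–52) [Turan1951Carlson]; proof reproduced in
  Y. Cheng, M. Hassani, G. Fox, arXiv:1010.3371v2, §6 [ChengHassaniFox2010].
* P. Turán, *On a New Method of Analysis and its Applications*, Wiley 1984, §8 [Turan1984NewMethod].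
* H. Cartan 1928 (Cartan's lemma) [Cartan1928].
-/

noncomputable section

open Finset Polynomial Metric

namespace Literature.Analysis.Complex.PowerSum

open _root_.Complex _root_.MeasureTheory Literature.Analysis.Complex.Cartan

/-! ### The coefficient `ℓ¹`-norm: general inequalities -/

/-- Submultiplicativity of the truncated coefficient `ℓ¹`-norm. [folklore] -/
theorem coeffNorm_mul_le (M : ℕ) (f g : ℂ[X]) :
    coeffNorm M (f * g) ≤ coeffNorm M f * coeffNorm M g := by
  unfold coeffNorm
  have hcoeff : ∀ ν, ‖(f * g).coeff ν‖ ≤ ∑ p ∈ antidiagonal ν, ‖f.coeff p.1‖ * ‖g.coeff p.2‖ := by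
    intro ν
    rw [coeff_mul]
    refine (norm_sum_le _ _).trans (Finset.sum_le_sum fun p _ => ?_)
    rw [norm_mul]
  have h2 : ∑ ν ∈ range M, ∑ p ∈ antidiagonal ν, ‖f.coeff p.1‖ * ‖g.coeff p.2‖ ≤
      ∑ p ∈ range M ×ˢ range M, ‖f.coeff p.1‖ * ‖g.coeff p.2‖ := by
    rw [sum_sigma']
    set Sg := (range M).sigma fun ν => antidiagonal ν with hSg
    have hinj : ∀ a ∈ Sg, ∀ a' ∈ Sg, (fun q : (Σ _ : ℕ, ℕ × ℕ) => q.2) a = (fun q => q.2) a' → a = a' := by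
      rintro ⟨ν, p⟩ ha ⟨ν', p'⟩ ha' (h : p = p')
      simp only [hSg, mem_sigma, mem_antidiagonal] at ha ha'
      subst h
      have : ν = ν' := by omega
      subst this
      rfl
    rw [← Finset.sum_image (g := fun q : (Σ _ : ℕ, ℕ × ℕ) => q.2)
      (f := fun p : ℕ × ℕ => ‖f.coeff p.1‖ * ‖g.coeff p.2‖) hinj]
    refine sum_le_sum_of_subset_of_nonneg ?_ (fun _ _ _ => mul_nonneg (norm_nonneg _) (norm_nonneg _))
    intro p hp
    rw [mem_image] at hp
    obtain ⟨⟨ν, p'⟩, hx, rfl⟩ := hp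
    simp only [hSg, mem_sigma, mem_range, mem_antidiagonal] at hx
    simp only [mem_product, mem_range]
    omega
  calc ∑ ν ∈ range M, ‖(f * g).coeff ν‖
      ≤ ∑ ν ∈ range M, ∑ p ∈ antidiagonal ν, ‖f.coeff p.1‖ * ‖g.coeff p.2‖ :=
        Finset.sum_le_sum fun ν _ => hcoeff ν
    _ ≤ ∑ p ∈ range M ×ˢ range M, ‖f.coeff p.1‖ * ‖g.coeff p.2‖ := h2
    _ = (∑ k ∈ range M, ‖f.coeff k‖) * ∑ k ∈ range M, ‖g.coeff k‖ := by
        rw [sum_product, sum_mul]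
        refine sum_congr rfl fun k _ => ?_
        rw [mul_sum]

/-- Triangle inequality for the coefficient norm. [folklore] -/
theorem coeffNorm_add_le (M : ℕ) (f g : ℂ[X]) : coeffNorm M (f + g) ≤ coeffNorm M f + coeffNorm M g := by
  unfold coeffNorm
  rw [← sum_add_distrib]
  exact Finset.sum_le_sum fun k _ => by rw [coeff_add]; exact norm_add_le _ _

/-- `‖−f‖₁ = ‖f‖₁`. [folklore] -/
theorem coeffNorm_neg (M : ℕ) (f : ℂ[X]) : coeffNorm M (-f) = coeffNorm M f := by
  unfold coeffNorm
  exact sum_congr rfl fun k _ => by rw [coeff_neg, norm_neg]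

/-- `‖∑ f_t‖₁ ≤ ∑ ‖f_t‖₁`. [folklore] -/
theorem coeffNorm_sum_le {κ : Type*} (M : ℕ) (T : Finset κ) (f : κ → ℂ[X]) :
    coeffNorm M (∑ t ∈ T, f t) ≤ ∑ t ∈ T, coeffNorm M (f t) := by
  classical
  induction T using Finset.induction_on with
  | empty => simp [coeffNorm]
  | @insert a T ha ih =>
    rw [sum_insert ha, sum_insert ha]
    exact (coeffNorm_add_le M _ _).trans (add_le_add le_rfl ih)

/-- `‖C a · f‖₁ = |a| ‖f‖₁`. [folklore] -/
theorem coeffNorm_C_mul (M : ℕ) (a : ℂ) (f : ℂ[X]) : coeffNorm M (Polynomial.C a * f) = ‖a‖ * coeffNorm M f := by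
  unfold coeffNorm
  rw [mul_sum]
  exact sum_congr rfl fun k _ => by rw [coeff_C_mul, norm_mul]

/-- `‖C a‖₁ ≤ |a|`. [folklore] -/
theorem coeffNorm_C_le (M : ℕ) (a : ℂ) : coeffNorm M (Polynomial.C a) ≤ ‖a‖ := by
  unfold coeffNorm
  calc ∑ k ∈ range M, ‖(Polynomial.C a).coeff k‖ = ∑ k ∈ range M, (if k = 0 then ‖a‖ else 0) := by
        refine sum_congr rfl fun k _ => ?_
        rw [coeff_C]
        split_ifs <;> simp
    _ ≤ ‖a‖ := by
        rw [sum_ite_eq']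
        split_ifs <;> simp

/-- `‖X^m‖₁ ≤ 1`. [folklore] -/
theorem coeffNorm_X_pow_le (M m : ℕ) : coeffNorm M ((Polynomial.X : ℂ[X]) ^ m) ≤ 1 := by
  unfold coeffNorm
  calc ∑ k ∈ range M, ‖((Polynomial.X : ℂ[X]) ^ m).coeff k‖ = ∑ k ∈ range M, (if k = m then (1:ℝ) else 0) := by
        refine sum_congr rfl fun k _ => ?_
        rw [coeff_X_pow]
        split_ifs <;> simp
    _ ≤ 1 := by
        rw [sum_ite_eq']
        split_ifs <;> simp

/-- `‖X − C a‖₁ ≤ 1 + |a|`. [folklore] -/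
theorem coeffNorm_X_sub_C_le (M : ℕ) (a : ℂ) : coeffNorm M (Polynomial.X - Polynomial.C a) ≤ 1 + ‖a‖ := by
  rw [sub_eq_add_neg, ← map_neg Polynomial.C a]
  refine (coeffNorm_add_le M _ _).trans (add_le_add ?_ ?_)
  · simpa using coeffNorm_X_pow_le M 1
  · simpa using coeffNorm_C_le M (-a)

/-- `‖∏ f_t‖₁ ≤ ∏ ‖f_t‖₁` (for `M ≥ 1`, so that `‖1‖₁ = 1`). [folklore] -/
theorem coeffNorm_prod_le {κ : Type*} (M : ℕ) (T : Finset κ) (f : κ → ℂ[X]) :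
    coeffNorm M (∏ t ∈ T, f t) ≤ ∏ t ∈ T, coeffNorm M (f t) := by
  classical
  induction T using Finset.induction_on with
  | empty =>
    simp only [prod_empty]
    have : coeffNorm M (1 : ℂ[X]) ≤ 1 := by simpa using coeffNorm_X_pow_le M 0
    exact this
  | @insert a T ha ih =>
    rw [prod_insert ha, prod_insert ha]
    exact (coeffNorm_mul_le M _ _).trans
      (mul_le_mul_of_nonneg_left ih (coeffNorm_nonneg _ _))

/-- A polynomial of degree `< M` evaluated through its coefficients, paired with a sequence:
`|∑_{k<M} [X^k]f · a_k| ≤ ‖f‖₁ · A` whenever `|a_k| ≤ A` on the indices where `[X^k] f ≠ 0`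
matters — here simply for all `k < M` with `[X^k]f ≠ 0`. [folklore] -/
theorem norm_sum_coeff_mul_le (M : ℕ) (f : ℂ[X]) (a : ℕ → ℂ) {A : ℝ}
    (ha : ∀ k ∈ range M, f.coeff k ≠ 0 → ‖a k‖ ≤ A) :
    ‖∑ k ∈ range M, f.coeff k * a k‖ ≤ coeffNorm M f * A := by
  unfold coeffNorm
  rw [sum_mul]
  refine (norm_sum_le _ _).trans (Finset.sum_le_sum fun k hk => ?_)
  by_cases h0 : f.coeff k = 0
  · simp [h0]
  · rw [norm_mul]
    exact mul_le_mul_of_nonneg_left (ha k hk h0) (norm_nonneg _)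

/-! ### Newton basis, the `u`-side products, and the telescoping identity -/

/-- Newton basis polynomial `N_t = ∏_{t' < t} (X − x_{t'})`. [folklore] -/
def newtonBasis (x : ℕ → ℂ) (t : ℕ) : ℂ[X] := ∏ t' ∈ range t, (Polynomial.X - Polynomial.C (x t'))

/-- `Ω_T(u) = ∏_{t' ∈ T} (1 − x_{t'} u)`. [folklore] -/
def omegaStar (x : ℕ → ℂ) (T : Finset ℕ) (u : ℂ) : ℂ := ∏ t' ∈ T, (1 - x t' * u)

/-- `N_t(w) = ∏_{t'<t} (w − x_{t'})`. [folklore] -/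
theorem eval_newtonBasis (x : ℕ → ℂ) (t : ℕ) (w : ℂ) :
    (newtonBasis x t).eval w = ∏ t' ∈ range t, (w - x t') := by
  rw [newtonBasis, eval_prod]
  simp

/-- `deg N_t ≤ t`. [folklore] -/
theorem natDegree_newtonBasis_le (x : ℕ → ℂ) (t : ℕ) : (newtonBasis x t).natDegree ≤ t := by
  unfold newtonBasis
  have h := Polynomial.natDegree_prod_le (range t) (fun t' => (Polynomial.X - Polynomial.C (x t') : ℂ[X]))
  refine h.trans (le_of_eq ?_)
  calc ∑ t' ∈ range t, (Polynomial.X - Polynomial.C (x t') : ℂ[X]).natDegree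
      = ∑ t' ∈ range t, (1 : ℕ) := sum_congr rfl fun t' _ => natDegree_X_sub_C (x t')
    _ = t := by simp

/-- `‖N_t‖₁ ≤ 2^t` when `|x_{t'}| ≤ 1`. [folklore] -/
theorem coeffNorm_newtonBasis_le (M : ℕ) (x : ℕ → ℂ) (hx : ∀ t', ‖x t'‖ ≤ 1) (t : ℕ) :
    coeffNorm M (newtonBasis x t) ≤ (2 : ℝ) ^ t := by
  unfold newtonBasis
  refine (coeffNorm_prod_le M _ _).trans ?_
  calc ∏ t' ∈ range t, coeffNorm M (Polynomial.X - Polynomial.C (x t')) ≤ ∏ _t' ∈ range t, (2 : ℝ) := by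
        refine prod_le_prod (fun _ _ => coeffNorm_nonneg _ _) fun t' _ => ?_
        exact (coeffNorm_X_sub_C_le M _).trans (by linarith [hx t'])
    _ = (2 : ℝ) ^ t := by simp

/-- **Telescoping identity behind Newton interpolation** (in the variable `u = 1/z`): for
`τ < l` and `u` with `1 − x_t u ≠ 0` (`t < l`),
`∑_{t<l} u^t N_t(x_τ) / Ω_{t+1}(u) = 1/(1 − x_τ u)`. [folklore] -/
theorem sum_newton_telescope (x : ℕ → ℂ) {l τ : ℕ} (hτ : τ < l) (u : ℂ)
    (hu : ∀ t < l, 1 - x t * u ≠ 0) :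
    ∑ t ∈ range l, u ^ t * (newtonBasis x t).eval (x τ) / omegaStar x (range (t + 1)) u =
      1 / (1 - x τ * u) := by
  -- `a_t = ∏_{t'<t} u (x_τ − x_{t'}) / (1 − x_{t'} u)`
  set a : ℕ → ℂ := fun t => ∏ t' ∈ range t, (u * (x τ - x t') / (1 - x t' * u)) with ha
  have hxτ : 1 - x τ * u ≠ 0 := hu τ hτ
  -- summand `= a_t / (1 − x_t u) = (a_t − a_{t+1}) / (1 − x_τ u)`
  have hsummand : ∀ t ∈ range l,
      u ^ t * (newtonBasis x t).eval (x τ) / omegaStar x (range (t + 1)) u =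
        (a t - a (t + 1)) / (1 - x τ * u) := by
    intro t ht
    rw [mem_range] at ht
    have hxt : 1 - x t * u ≠ 0 := hu t ht
    have hat : a t = (u ^ t * ∏ t' ∈ range t, (x τ - x t')) / ∏ t' ∈ range t, (1 - x t' * u) := by
      rw [ha]; dsimp only
      rw [prod_div_distrib, prod_mul_distrib, prod_const, card_range]
    have h1 : u ^ t * (newtonBasis x t).eval (x τ) / omegaStar x (range (t + 1)) u =
        a t / (1 - x t * u) := by
      rw [eval_newtonBasis, omegaStar, prod_range_succ, hat, div_div]
    have h2 : a (t + 1) = a t * (u * (x τ - x t) / (1 - x t * u)) := by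
      rw [ha]; dsimp only; rw [prod_range_succ]
    rw [h1, h2]
    have hxt' : 1 - u * x t ≠ 0 := by rwa [mul_comm] at hxt
    have hxτ' : 1 - u * x τ ≠ 0 := by rwa [mul_comm] at hxτ
    field_simp
    ring
  rw [sum_congr rfl hsummand, ← sum_div, Finset.sum_range_sub', ha]
  dsimp only
  rw [prod_range_zero]
  -- `a_l = 0`: the factor `t' = τ` vanishes
  have hal : ∏ t' ∈ range l, (u * (x τ - x t') / (1 - x t' * u)) = 0 :=
    prod_eq_zero (mem_range.2 hτ) (by simp)
  rw [hal, sub_zero]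

/-! ### The interpolant via contour integrals (Turán 1951 / Newton, `z = 1/u`) -/

section Interpolant

variable {ι : Type*} (Sm : Finset ι) (z : ι → ℂ) (x : ℕ → ℂ) (ρ : ℝ) (D l : ℕ)

/-- `P(w) = ∏_{small} (w − z_m)`. [folklore] -/
def smallPoly : ℂ[X] := ∏ m ∈ Sm, (Polynomial.X - Polynomial.C (z m))

/-- `P*(u) = ∏_{small} (1 − z_m u)` (`= u^k P(1/u)`). [folklore] -/
def smallStar (u : ℂ) : ℂ := ∏ m ∈ Sm, (1 - z m * u)

/-- The integrand of the `t`-th Newton coefficient: `u^{D+k+t} / (P*(u) Ω_{t+1}(u))`. [folklore] -/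
def newtonIntegrand (t : ℕ) (u : ℂ) : ℂ :=
  u ^ (D + Sm.card + t) / (smallStar Sm z u * omegaStar x (range (t + 1)) u)

/-- The `t`-th Newton coefficient `β_t = (2πi)⁻¹ ∮_{|u|=ρ} u^{D+k+t} du / (P*(u) Ω_{t+1}(u))`.
[cite: Turan1951Carlson, Lemma III (p. 48–52)] -/
def newtonCoeff (t : ℕ) : ℂ :=
  (2 * Real.pi * I)⁻¹ * ∮ u in C(0, ρ), newtonIntegrand Sm z x D t u

/-- The interpolating polynomial `Q = −∑_{t<l} β_t N_t`. [cite: Turan1951Carlson, Lemma III] -/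
def interpQ : ℂ[X] := -∑ t ∈ range l, Polynomial.C (newtonCoeff Sm z x ρ D t) * newtonBasis x t

variable {Sm z x ρ D l}

/-- `P(w) = ∏_{small} (w − z_m)`. [folklore] -/
theorem eval_smallPoly (w : ℂ) : (smallPoly Sm z).eval w = ∏ m ∈ Sm, (w - z m) := by
  rw [smallPoly, eval_prod]; simp

/-- `P*(u) ≠ 0` on `|u| ≤ ρ` when all small nodes have `|z_m| < ρ⁻¹`. [folklore] -/
theorem smallStar_ne_zero (hρ : 0 < ρ) (hz : ∀ m ∈ Sm, ‖z m‖ < ρ⁻¹) {u : ℂ} (hu : ‖u‖ ≤ ρ) :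
    smallStar Sm z u ≠ 0 := by
  rw [smallStar]
  refine prod_ne_zero_iff.2 fun m hm h => ?_
  have h1 : z m * u = 1 := by linear_combination -h
  have h2 : ‖z m * u‖ < 1 := by
    rw [norm_mul]
    calc ‖z m‖ * ‖u‖ ≤ ‖z m‖ * ρ := mul_le_mul_of_nonneg_left hu (norm_nonneg _)
      _ < ρ⁻¹ * ρ := by
          have := hz m hm
          by_cases h0 : ‖z m‖ * ρ < ρ⁻¹ * ρ
          · exact h0
          · exact absurd (mul_lt_mul_of_pos_right this hρ) h0
      _ = 1 := inv_mul_cancel₀ hρ.ne'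
  rw [h1, norm_one] at h2
  exact lt_irrefl _ h2

/-- `1 − x_t u ≠ 0` on `|u| = ρ` when the large node has `|x_t| > ρ⁻¹`. [folklore] -/
theorem one_sub_large_mul_ne_zero (hρ : 0 < ρ) {y : ℂ} (hy : ρ⁻¹ < ‖y‖) {u : ℂ} (hu : ‖u‖ = ρ) :
    1 - y * u ≠ 0 := by
  intro h
  have h1 : y * u = 1 := by linear_combination -h
  have h2 : 1 < ‖y * u‖ := by
    rw [norm_mul, hu]
    calc (1 : ℝ) = ρ⁻¹ * ρ := (inv_mul_cancel₀ hρ.ne').symm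
      _ < ‖y‖ * ρ := mul_lt_mul_of_pos_right hy hρ
  rw [h1, norm_one] at h2
  exact lt_irrefl _ h2

/-- The holomorphic part `g(u) = u^{D+k}/P*(u)` is differentiable on `|u| ≤ ρ`. [folklore] -/
theorem differentiableOn_core (hρ : 0 < ρ) (hz : ∀ m ∈ Sm, ‖z m‖ < ρ⁻¹) :
    DifferentiableOn ℂ (fun u : ℂ => u ^ (D + Sm.card) / smallStar Sm z u) (closedBall 0 ρ) := by
  refine DifferentiableOn.div (Differentiable.differentiableOn (by fun_prop)) ?_ ?_
  · unfold smallStar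
    exact Differentiable.differentiableOn (by fun_prop)
  · intro u hu
    exact smallStar_ne_zero hρ hz (by simpa using hu)

/-- **The key identity** (Newton interpolation through contour integrals): for `τ < l`,
`∑_{t<l} β_t N_t(x_τ) = −1/(x_τ^{D+1} P(x_τ))`. Here `β_t` are the divided differences of
`G(z) = 1/(z^{D+1}P(z))` at `x_0, …, x_t`, computed as integrals over `|u| = ρ` (`u = 1/z`), on and
inside which the only singularity of the transformed integrand for `τ` is the simple pole at
`u = 1/x_τ` (Cauchy's integral formula). [cite: Turan1951Carlson, Lemma III (p. 48–52)] -/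
theorem sum_newtonCoeff_mul_eval (hρ : 0 < ρ) (hz : ∀ m ∈ Sm, ‖z m‖ < ρ⁻¹)
    (hx : ∀ t < l, ρ⁻¹ < ‖x t‖) {τ : ℕ} (hτ : τ < l) :
    ∑ t ∈ range l, newtonCoeff Sm z x ρ D t * (newtonBasis x t).eval (x τ) =
      -((x τ) ^ (D + 1) * (smallPoly Sm z).eval (x τ))⁻¹ := by
  set k := Sm.card with hk
  have hxτ : ρ⁻¹ < ‖x τ‖ := hx τ hτ
  have hxτ0 : x τ ≠ 0 := by
    intro h; rw [h, norm_zero] at hxτ; exact absurd hxτ (not_lt.2 (inv_pos.2 hρ).le)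
  -- the point `w = 1/x_τ` inside the circle
  set w : ℂ := (x τ)⁻¹ with hw
  have hwball : w ∈ ball (0 : ℂ) ρ := by
    rw [mem_ball, dist_zero_right, hw, norm_inv]
    calc ‖x τ‖⁻¹ < (ρ⁻¹)⁻¹ := by
          exact inv_strictAnti₀ (inv_pos.2 hρ) hxτ
      _ = ρ := inv_inv ρ
  -- the core holomorphic function and the rewritten integrand
  set g : ℂ → ℂ := fun u => -(x τ)⁻¹ * (u ^ (D + k) / smallStar Sm z u) with hg
  -- Step 1: pull the evaluation inside and sum the integrals
  have hint : ∀ t ∈ range l, CircleIntegrable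
      (fun u => newtonIntegrand Sm z x D t u * (newtonBasis x t).eval (x τ)) 0 ρ := by
    intro t ht
    rw [mem_range] at ht
    refine ContinuousOn.circleIntegrable hρ.le (ContinuousOn.mul ?_ continuousOn_const)
    unfold newtonIntegrand
    refine ContinuousOn.div (Continuous.continuousOn (by fun_prop)) ?_ ?_
    · unfold smallStar omegaStar
      exact Continuous.continuousOn (by fun_prop)
    · intro u hu
      have hu' : ‖u‖ = ρ := by simpa [abs_of_pos hρ] using hu
      refine mul_ne_zero (smallStar_ne_zero hρ hz hu'.le) ?_
      unfold omegaStar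
      refine prod_ne_zero_iff.2 fun t' ht' => ?_
      rw [mem_range] at ht'
      exact one_sub_large_mul_ne_zero hρ (hx t' (by omega)) hu'
  have hstep1 : ∑ t ∈ range l, newtonCoeff Sm z x ρ D t * (newtonBasis x t).eval (x τ) =
      (2 * Real.pi * I)⁻¹ * ∮ u in C(0, ρ), ∑ t ∈ range l,
        newtonIntegrand Sm z x D t u * (newtonBasis x t).eval (x τ) := by
    rw [circleIntegral.integral_fun_sum hint, mul_sum]
    refine sum_congr rfl fun t _ => ?_
    have hswap : (∮ u in C(0, ρ), newtonIntegrand Sm z x D t u * (newtonBasis x t).eval (x τ)) =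
        (newtonBasis x t).eval (x τ) * ∮ u in C(0, ρ), newtonIntegrand Sm z x D t u := by
      rw [← circleIntegral.integral_const_mul]
      exact circleIntegral.integral_congr hρ.le fun u _ => by ring
    rw [hswap, newtonCoeff]
    ring
  -- Step 2: on the circle the summed integrand is `(u − w)⁻¹ • g u`
  have hstep2 : ∀ u ∈ sphere (0 : ℂ) ρ,
      ∑ t ∈ range l, newtonIntegrand Sm z x D t u * (newtonBasis x t).eval (x τ) = (u - w)⁻¹ • g u := by
    intro u hu
    have hu' : ‖u‖ = ρ := by simpa using hu
    have hne : ∀ t < l, 1 - x t * u ≠ 0 := fun t ht => one_sub_large_mul_ne_zero hρ (hx t ht) hu'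
    have hP : smallStar Sm z u ≠ 0 := smallStar_ne_zero hρ hz hu'.le
    have htel := sum_newton_telescope x hτ u hne
    have hxτu : 1 - x τ * u ≠ 0 := hne τ hτ
    have huw : u - w ≠ 0 := by
      rw [hw]; intro h
      apply hxτu
      have : u = (x τ)⁻¹ := by linear_combination h
      rw [this, mul_inv_cancel₀ hxτ0, sub_self]
    calc ∑ t ∈ range l, newtonIntegrand Sm z x D t u * (newtonBasis x t).eval (x τ)
        = u ^ (D + k) / smallStar Sm z u *
            ∑ t ∈ range l, u ^ t * (newtonBasis x t).eval (x τ) / omegaStar x (range (t + 1)) u := by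
          rw [mul_sum]
          refine sum_congr rfl fun t _ => ?_
          rw [newtonIntegrand, ← hk, pow_add]
          field_simp
      _ = u ^ (D + k) / smallStar Sm z u * (1 / (1 - x τ * u)) := by rw [htel]
      _ = (u - w)⁻¹ • g u := by
          have huw' : u - (x τ)⁻¹ ≠ 0 := by rwa [hw] at huw
          have hkey : (u - w)⁻¹ * (-(x τ)⁻¹) = 1 / (1 - x τ * u) := by
            have h2 : 1 - x τ * u = -(x τ) * (u - (x τ)⁻¹) := by
              rw [mul_sub, neg_mul, neg_mul, mul_inv_cancel₀ hxτ0]; ring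
            rw [hw, h2]
            field_simp
          rw [smul_eq_mul, hg]; dsimp only
          rw [← hkey]
          ring
  -- Step 3: Cauchy's integral formula for `g` at `w`
  have hgdiff : DifferentiableOn ℂ g (closedBall 0 ρ) := by
    rw [hg]
    exact DifferentiableOn.mul (differentiableOn_const _) (differentiableOn_core hρ hz)
  have hcauchy := hgdiff.circleIntegral_sub_inv_smul hwball
  rw [hstep1, circleIntegral.integral_congr hρ.le hstep2, hcauchy, smul_eq_mul, ← mul_assoc,
    inv_mul_cancel₀ (by simp [Real.pi_ne_zero, I_ne_zero]), one_mul]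
  -- Step 4: evaluate `g(w)`: `P*(1/x_τ) = x_τ^{-k} P(x_τ)`
  rw [hg, hw]; dsimp only
  have hstar : smallStar Sm z (x τ)⁻¹ = ((x τ)⁻¹) ^ k * (smallPoly Sm z).eval (x τ) := by
    rw [smallStar, eval_smallPoly, hk, ← prod_const, ← prod_mul_distrib]
    refine prod_congr rfl fun m _ => ?_
    rw [mul_sub, inv_mul_cancel₀ hxτ0]
    ring
  rw [hstar]
  have hP0 : (smallPoly Sm z).eval (x τ) ≠ 0 := by
    rw [eval_smallPoly]
    refine prod_ne_zero_iff.2 fun m hm h => ?_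
    have : x τ = z m := by linear_combination h
    have h1 := hz m hm
    rw [← this] at h1
    exact absurd (hxτ.trans h1) (lt_irrefl _)
  rw [mul_inv, ← inv_pow]
  set v : ℂ := (x τ)⁻¹ with hv
  have hv0 : v ≠ 0 := inv_ne_zero hxτ0
  rw [pow_add, pow_succ]
  field_simp

/-- `Q(x_τ) · x_τ^{D+1} P(x_τ) = 1` at every large node. [cite: Turan1951Carlson, Lemma III] -/
theorem eval_interpQ_mul (hρ : 0 < ρ) (hz : ∀ m ∈ Sm, ‖z m‖ < ρ⁻¹)
    (hx : ∀ t < l, ρ⁻¹ < ‖x t‖) {τ : ℕ} (hτ : τ < l) :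
    (interpQ Sm z x ρ D l).eval (x τ) * ((x τ) ^ (D + 1) * (smallPoly Sm z).eval (x τ)) = 1 := by
  have hxτ : ρ⁻¹ < ‖x τ‖ := hx τ hτ
  have hxτ0 : x τ ≠ 0 := by
    intro h; rw [h, norm_zero] at hxτ; exact absurd hxτ (not_lt.2 (inv_pos.2 hρ).le)
  have hP0 : (smallPoly Sm z).eval (x τ) ≠ 0 := by
    rw [eval_smallPoly]
    refine prod_ne_zero_iff.2 fun m hm h => ?_
    have : x τ = z m := by linear_combination h
    have h1 := hz m hm
    rw [← this] at h1
    exact absurd (hxτ.trans h1) (lt_irrefl _)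
  have heval : (interpQ Sm z x ρ D l).eval (x τ) =
      -∑ t ∈ range l, newtonCoeff Sm z x ρ D t * (newtonBasis x t).eval (x τ) := by
    rw [interpQ, eval_neg, eval_finsetSum]
    simp only [eval_mul, eval_C]
  rw [heval, sum_newtonCoeff_mul_eval hρ hz hx hτ, neg_neg,
    inv_mul_cancel₀ (mul_ne_zero (pow_ne_zero _ hxτ0) hP0)]

/-- Degree of `Q`: `< l`. [folklore] -/
theorem natDegree_interpQ_le (hl : 1 ≤ l) : (interpQ Sm z x ρ D l).natDegree ≤ l - 1 := by
  rw [interpQ, natDegree_neg]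
  refine natDegree_sum_le_of_forall_le _ _ fun t ht => ?_
  rw [mem_range] at ht
  calc (Polynomial.C (newtonCoeff Sm z x ρ D t) * newtonBasis x t).natDegree
      ≤ (newtonBasis x t).natDegree := natDegree_C_mul_le _ _
    _ ≤ t := natDegree_newtonBasis_le x t
    _ ≤ l - 1 := by omega

/-- **Bound for the Newton coefficients** from a lower bound `μ₂` for the relevant sub-products on
the circle `|z| = ρ⁻¹`: if `∏_{small}|ζ − z_m| · ∏_{t'≤t}|ζ − x_{t'}| ≥ μ₂` for all `|ζ| = ρ⁻¹`, then
`|β_t| ≤ ρ^D / μ₂`. [cite: Turan1951Carlson, Lemma III (6.10 in arXiv:1010.3371)] -/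
theorem norm_newtonCoeff_le (hρ : 0 < ρ) {t : ℕ} {μ₂ : ℝ} (hμ₂ : 0 < μ₂)
    (hsub : ∀ ζ : ℂ, ‖ζ‖ = ρ⁻¹ →
      μ₂ ≤ (∏ m ∈ Sm, ‖ζ - z m‖) * ∏ t' ∈ range (t + 1), ‖ζ - x t'‖) :
    ‖newtonCoeff Sm z x ρ D t‖ ≤ ρ ^ D / μ₂ := by
  set k := Sm.card with hk
  have hbound : ∀ u ∈ sphere (0 : ℂ) ρ, ‖newtonIntegrand Sm z x D t u‖ ≤ ρ ^ D * ρ⁻¹ / μ₂ := by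
    intro u hu
    have hu' : ‖u‖ = ρ := by simpa using hu
    have hu0 : u ≠ 0 := by intro h; rw [h, norm_zero] at hu'; exact hρ.ne' hu'.symm
    set ζ : ℂ := u⁻¹ with hζ
    have hζn : ‖ζ‖ = ρ⁻¹ := by rw [hζ, norm_inv, hu']
    -- `|1 − a u| = |u| |ζ − a|`
    have hfac : ∀ a : ℂ, ‖1 - a * u‖ = ρ * ‖ζ - a‖ := by
      intro a
      have : 1 - a * u = u * (ζ - a) := by rw [hζ, mul_sub, mul_inv_cancel₀ hu0]; ring
      rw [this, norm_mul, hu']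
    have hP : ‖smallStar Sm z u‖ = ρ ^ k * ∏ m ∈ Sm, ‖ζ - z m‖ := by
      rw [smallStar, norm_prod, hk, ← prod_const, ← prod_mul_distrib]
      exact prod_congr rfl fun m _ => hfac (z m)
    have hΩ : ‖omegaStar x (range (t + 1)) u‖ = ρ ^ (t + 1) * ∏ t' ∈ range (t + 1), ‖ζ - x t'‖ := by
      rw [omegaStar, norm_prod, ← card_range (t + 1), ← prod_const, card_range, ← prod_mul_distrib]
      exact prod_congr rfl fun t' _ => hfac (x t')
    have hsubζ := hsub ζ hζn
    set A : ℝ := ∏ m ∈ Sm, ‖ζ - z m‖ with hA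
    set B : ℝ := ∏ t' ∈ range (t + 1), ‖ζ - x t'‖ with hB
    have hAB : 0 < A * B := hμ₂.trans_le hsubζ
    rw [newtonIntegrand, norm_div, norm_mul, norm_pow, hu', hP, hΩ]
    have heq : ρ ^ (D + Sm.card + t) / (ρ ^ k * A * (ρ ^ (t + 1) * B)) = ρ ^ D * ρ⁻¹ / (A * B) := by
      rw [← hk]
      field_simp
      ring
    rw [heq]
    exact div_le_div_of_nonneg_left (by positivity) hμ₂ hsubζ
  have h := circleIntegral.norm_two_pi_i_inv_smul_integral_le_of_norm_le_const hρ.le hbound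
  rw [newtonCoeff]
  rw [smul_eq_mul] at h
  calc _ ≤ ρ * (ρ ^ D * ρ⁻¹ / μ₂) := h
    _ = ρ ^ D / μ₂ := by field_simp

/-- Coefficient norm of `Q`: `‖Q‖₁ ≤ 2^l ρ^D/μ₂` under the uniform sub-product bound and
`|x_t| ≤ 1`. [cite: Turan1951Carlson, Lemma III] -/
theorem coeffNorm_interpQ_le (M : ℕ) (hρ : 0 < ρ) (hx1 : ∀ t, ‖x t‖ ≤ 1) {μ₂ : ℝ} (hμ₂ : 0 < μ₂)
    (hsub : ∀ t < l, ∀ ζ : ℂ, ‖ζ‖ = ρ⁻¹ →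
      μ₂ ≤ (∏ m ∈ Sm, ‖ζ - z m‖) * ∏ t' ∈ range (t + 1), ‖ζ - x t'‖) :
    coeffNorm M (interpQ Sm z x ρ D l) ≤ (2 : ℝ) ^ l * (ρ ^ D / μ₂) := by
  rw [interpQ, coeffNorm_neg]
  refine (coeffNorm_sum_le M _ _).trans ?_
  calc ∑ t ∈ range l, coeffNorm M (Polynomial.C (newtonCoeff Sm z x ρ D t) * newtonBasis x t)
      ≤ ∑ t ∈ range l, (ρ ^ D / μ₂) * (2 : ℝ) ^ t := by
        refine Finset.sum_le_sum fun t ht => ?_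
        rw [mem_range] at ht
        rw [coeffNorm_C_mul]
        exact mul_le_mul (norm_newtonCoeff_le hρ hμ₂ (hsub t ht))
          (coeffNorm_newtonBasis_le M x hx1 t) (coeffNorm_nonneg _ _) (by positivity)
    _ = (ρ ^ D / μ₂) * ∑ t ∈ range l, (2 : ℝ) ^ t := by rw [mul_sum]
    _ ≤ (ρ ^ D / μ₂) * (2 : ℝ) ^ l := by
        refine mul_le_mul_of_nonneg_left ?_ (by positivity)
        have := geom_sum_eq (show (2 : ℝ) ≠ 1 by norm_num) l
        rw [this]
        norm_num
    _ = _ := mul_comm _ _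

end Interpolant

/-! ### The second main theorem -/

/-- Pairing coefficients with power sums: for a polynomial `R` of degree `< M`,
`∑_{ν<M} [X^ν]R · (∑_j b_j z_j^ν) = ∑_j b_j R(z_j)`. [folklore] -/
theorem sum_coeff_mul_powerSum {ι : Type*} (s : Finset ι) (z : ι → ℂ) (b : ι → ℂ) (R : ℂ[X])
    {M : ℕ} (hM : R.natDegree < M) :
    ∑ ν ∈ range M, R.coeff ν * ∑ j ∈ s, b j * z j ^ ν = ∑ j ∈ s, b j * R.eval (z j) := by
  calc ∑ ν ∈ range M, R.coeff ν * ∑ j ∈ s, b j * z j ^ ν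
      = ∑ ν ∈ range M, ∑ j ∈ s, b j * (R.coeff ν * z j ^ ν) := by
        refine sum_congr rfl fun ν _ => ?_
        rw [mul_sum]
        exact sum_congr rfl fun j _ => by ring
    _ = ∑ j ∈ s, ∑ ν ∈ range M, b j * (R.coeff ν * z j ^ ν) := sum_comm
    _ = ∑ j ∈ s, b j * R.eval (z j) := by
        refine sum_congr rfl fun j _ => ?_
        rw [← mul_sum, eval_eq_sum_range' hM]

/-- `1 − y ≥ e^{−2y}` for `0 ≤ y ≤ 1/2`. (The same inequality is proved as
`Literature.NumberTheory.LFunctions.Nicolas.exp_neg_two_mul_le` in `NicolasOmega.lean`; re-proved in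
five lines rather than importing that number-theoretic module here.) [folklore] -/
theorem exp_neg_two_mul_le_one_sub {y : ℝ} (hy0 : 0 ≤ y) (hy : y ≤ 1 / 2) :
    Real.exp (-(2 * y)) ≤ 1 - y := by
  -- `e^{-2y} ≤ 1/(1 + 2y) ≤ 1 − y` on `[0, 1/2]`
  have h1 : Real.exp (-(2 * y)) ≤ 1 / (1 + 2 * y) := by
    rw [Real.exp_neg, one_div]
    exact inv_anti₀ (by linarith) (by linarith [Real.add_one_le_exp (2 * y)])
  refine h1.trans ?_
  rw [div_le_iff₀ (by linarith)]
  nlinarith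

/-! ### The two case constants against the target constant -/

/-- The target constant `e⁻ⁿ (n/(250(D+n)))^{n+1}` is below the case-1 constant
`e⁻ⁿ/(2ⁿ C(D+n+1, n+1))`. [folklore] -/
theorem targetConst_le_case1 {n : ℕ} (hn : 1 ≤ n) (D : ℕ) :
    Real.exp (-(n : ℝ)) * ((n : ℝ) / (250 * (D + n))) ^ (n + 1) ≤
      Real.exp (-(n : ℝ)) / ((2 : ℝ) ^ n * ((D + n + 1).choose (n + 1) : ℝ)) := by
  have hnpos : (0 : ℝ) < n := by exact_mod_cast hn
  have hD : (0 : ℝ) ≤ D := Nat.cast_nonneg D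
  have hDn : (0 : ℝ) < D + n := by linarith
  have hCpos : (0 : ℝ) < (2 : ℝ) ^ n * ((D + n + 1).choose (n + 1) : ℝ) := by
    have : 0 < (D + n + 1).choose (n + 1) := Nat.choose_pos (by omega)
    positivity
  rw [le_div_iff₀ hCpos]
  have hch := choose_le_exp_mul_div_pow (D + n + 1) (n + 1) (by omega)
  have he : Real.exp 1 ≤ 3 := by
    have := Real.exp_one_lt_d9; norm_num at this; linarith
  set a : ℝ := (n : ℝ) / (250 * (D + n)) with ha
  have ha0 : 0 ≤ a := by positivity
  -- `a^{n+1} 2ⁿ C ≤ (2 a e (D+n+1)/(n+1))^{n+1} ≤ 1`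
  have hkey : a ^ (n + 1) * ((2 : ℝ) ^ n * ((D + n + 1).choose (n + 1) : ℝ)) ≤ 1 := by
    calc a ^ (n + 1) * ((2 : ℝ) ^ n * ((D + n + 1).choose (n + 1) : ℝ))
        ≤ a ^ (n + 1) * ((2 : ℝ) ^ (n + 1) * (Real.exp 1 * (D + n + 1 : ℕ) / (n + 1 : ℕ)) ^ (n + 1)) := by
          refine mul_le_mul_of_nonneg_left ?_ (by positivity)
          exact mul_le_mul (pow_le_pow_right₀ (by norm_num) (by omega)) hch (by positivity)
            (by positivity)
      _ = (a * (2 * (Real.exp 1 * (D + n + 1 : ℕ) / (n + 1 : ℕ)))) ^ (n + 1) := by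
          rw [mul_pow, mul_pow]
      _ ≤ 1 ^ (n + 1) := by
          refine pow_le_pow_left₀ (by positivity) ?_ _
          push_cast
          have h2 : (n : ℝ) * (D + n + 1) ≤ (n + 1) * (D + n) := by nlinarith
          have h3 : a * (2 * (Real.exp 1 * (D + n + 1) / (n + 1))) =
              (2 * Real.exp 1 / 250) * ((n : ℝ) * (D + n + 1) / ((n + 1) * (D + n))) := by
            rw [ha]; field_simp
          rw [h3]
          have h4 : (n : ℝ) * (D + n + 1) / ((n + 1) * (D + n)) ≤ 1 := by
            rw [div_le_one (by positivity)]; exact h2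
          have h5 : 0 ≤ (n : ℝ) * (D + n + 1) / ((n + 1) * (D + n)) := by positivity
          nlinarith [Real.exp_pos 1]
      _ = 1 := one_pow _
  calc Real.exp (-(n:ℝ)) * a ^ (n + 1) * ((2 : ℝ) ^ n * ((D + n + 1).choose (n + 1) : ℝ))
      = Real.exp (-(n:ℝ)) * (a ^ (n + 1) * ((2 : ℝ) ^ n * ((D + n + 1).choose (n + 1) : ℝ))) := by ring
    _ ≤ Real.exp (-(n:ℝ)) * 1 := mul_le_mul_of_nonneg_left hkey (Real.exp_pos _).le
    _ = _ := mul_one _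

/-- The target constant is below the case-2 constant `e⁻ⁿ · n!(H/n)ⁿ / 8ⁿ`, `H = n/(10(D+n))`
(using `nⁿ ≤ eⁿ n!` and `8e/25 < 1`). [folklore] -/
theorem targetConst_le_case2 {n : ℕ} (hn : 1 ≤ n) (D : ℕ) :
    Real.exp (-(n : ℝ)) * ((n : ℝ) / (250 * (D + n))) ^ (n + 1) ≤
      Real.exp (-(n : ℝ)) * (((n.factorial : ℕ) : ℝ) * ((n : ℝ) / (10 * (D + n)) / n) ^ n) / (8 : ℝ) ^ n := by
  have hnpos : (0 : ℝ) < n := by exact_mod_cast hn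
  have hD : (0 : ℝ) ≤ D := Nat.cast_nonneg D
  have hDn : (0 : ℝ) < D + n := by linarith
  rw [le_div_iff₀ (by positivity), mul_assoc]
  refine mul_le_mul_of_nonneg_left ?_ (Real.exp_pos _).le
  have hHn : (n : ℝ) / (10 * (D + n)) / n = 1 / (10 * (D + n)) := by
    field_simp
  rw [hHn]
  set a : ℝ := (n : ℝ) / (250 * (D + n)) with ha
  have ha0 : 0 ≤ a := by positivity
  have ha1 : a ≤ 1 := by
    rw [ha, div_le_one (by positivity)]; nlinarith
  have hfact : (n : ℝ) ^ n ≤ Real.exp 1 ^ n * (n.factorial : ℝ) := by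
    have := Real.pow_div_factorial_le_exp (n : ℝ) (by positivity) n
    rw [div_le_iff₀ (by positivity)] at this
    rwa [← Real.exp_nat_mul, mul_one] 
  have he : Real.exp 1 ≤ 3 := by
    have := Real.exp_one_lt_d9; norm_num at this; linarith
  calc a ^ (n + 1) * (8 : ℝ) ^ n ≤ a ^ n * (8 : ℝ) ^ n := by
        refine mul_le_mul_of_nonneg_right (pow_le_pow_of_le_one ha0 ha1 (by omega)) (by positivity)
    _ = ((8 : ℝ) / 25 * ((n : ℝ) * (1 / (10 * (D + n))))) ^ n := by
        rw [← mul_pow]; congr 1; rw [ha]; field_simp; ring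
    _ = ((8 : ℝ) / 25) ^ n * ((n : ℝ) ^ n * (1 / (10 * (D + n))) ^ n) := by
        rw [mul_pow, mul_pow]
    _ ≤ ((8 : ℝ) / 25) ^ n * ((Real.exp 1 ^ n * (n.factorial : ℝ)) * (1 / (10 * (D + n))) ^ n) := by
        gcongr
    _ = ((8 : ℝ) / 25 * Real.exp 1) ^ n * ((n.factorial : ℝ) * (1 / (10 * (D + n))) ^ n) := by
        rw [mul_pow]; ring
    _ ≤ 1 ^ n * ((n.factorial : ℝ) * (1 / (10 * (D + n))) ^ n) := by
        gcongr
        nlinarith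
    _ = ((n.factorial : ℕ) : ℝ) * (1 / (10 * ((D : ℝ) + n))) ^ n := by rw [one_pow, one_mul]

/-! ### The second main theorem -/

section MainProof

variable {ι : Type*} {s : Finset ι} {y : ι → ℂ} {b : ι → ℝ} {j₀ : ι} {D : ℕ} {r μ : ℝ}

/-- **Case 2 of Turán's argument.** Normalised nodes (`|y_j| ≤ 1`, repetitions allowed), nonnegative
weights, a radius `0 < r < 1` with no node of modulus `r`, `j₀` a node of modulus `> r`, and the
Cartan property `∏_{j ∈ s}|w − y_j| ≥ μ > 0` on `|w| = r`; if some node has modulus `< r`, then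
`max_{D < ν ≤ D+n} |S_ν| ≥ b_{j₀} μ r^D / 8ⁿ`. [cite: Turan1951Carlson, Lemma III (p. 49–52)] -/
theorem case_small (hb : ∀ j ∈ s, 0 ≤ b j) (hy1 : ∀ j ∈ s, ‖y j‖ ≤ 1)
    (hj₀ : j₀ ∈ s) (hj₀r : r < ‖y j₀‖) (hr : 0 < r) (hμ : 0 < μ)
    (hcircle : ∀ w : ℂ, ‖w‖ = r → μ ≤ ∏ i ∈ s, ‖w - y i‖)
    (hsmall : ∃ i ∈ s, ‖y i‖ < r) {ν₀ : ℕ}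
    (hν₀max : ∀ ν ∈ Icc (D + 1) (D + s.card),
      ‖∑ j ∈ s, (b j : ℂ) * y j ^ ν‖ ≤ ‖∑ j ∈ s, (b j : ℂ) * y j ^ ν₀‖) :
    b j₀ * (μ * r ^ D / (8 : ℝ) ^ s.card) ≤ ‖∑ j ∈ s, (b j : ℂ) * y j ^ ν₀‖ := by
  classical
  set n : ℕ := s.card with hn
  set S : ℕ → ℂ := fun ν => ∑ j ∈ s, (b j : ℂ) * y j ^ ν with hS
  -- no node on the circle; sub-products `≥ μ/2ⁿ`
  have hnot_on : ∀ i ∈ s, ‖y i‖ ≠ r := by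
    intro i hi h
    have := hcircle (y i) h
    rw [prod_eq_zero hi (by simp)] at this
    exact absurd this (not_le.2 hμ)
  have hsubprod : ∀ T : Finset ι, T ⊆ s → ∀ w : ℂ, ‖w‖ = r → μ / 2 ^ n ≤ ∏ i ∈ T, ‖w - y i‖ := by
    intro T hT w hw
    have hfull := hcircle w hw
    rw [← prod_sdiff hT] at hfull
    have hrest : ∏ i ∈ s \ T, ‖w - y i‖ ≤ (2 : ℝ) ^ n := by
      calc ∏ i ∈ s \ T, ‖w - y i‖ ≤ ∏ _i ∈ s \ T, (2 : ℝ) := by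
            refine prod_le_prod (fun _ _ => norm_nonneg _) fun i hi => ?_
            calc ‖w - y i‖ ≤ ‖w‖ + ‖y i‖ := norm_sub_le _ _
              _ ≤ 1 + 1 := add_le_add (by linarith [hw, hj₀r, hy1 j₀ hj₀]) (hy1 i (sdiff_subset hi))
              _ = 2 := by norm_num
        _ = (2 : ℝ) ^ (s \ T).card := by simp
        _ ≤ (2 : ℝ) ^ n := pow_le_pow_right₀ (by norm_num) (card_le_card sdiff_subset)
    have hT0 : 0 ≤ ∏ i ∈ T, ‖w - y i‖ := prod_nonneg fun _ _ => norm_nonneg _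
    rw [div_le_iff₀ (by positivity)]
    calc μ ≤ (∏ i ∈ s \ T, ‖w - y i‖) * ∏ i ∈ T, ‖w - y i‖ := hfull
      _ ≤ (2 : ℝ) ^ n * ∏ i ∈ T, ‖w - y i‖ := mul_le_mul_of_nonneg_right hrest hT0
      _ = _ := mul_comm _ _
  -- large and small nodes
  set Lg : Finset ι := s.filter fun i => r < ‖y i‖ with hLg
  set Sm : Finset ι := s.filter fun i => ‖y i‖ < r with hSm
  have hLgs : Lg ⊆ s := filter_subset _ _
  have hSms : Sm ⊆ s := filter_subset _ _
  have hj₀L : j₀ ∈ Lg := by rw [hLg, mem_filter]; exact ⟨hj₀, hj₀r⟩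
  have hunion : Lg ∪ Sm = s := by
    ext i
    simp only [hLg, hSm, mem_union, mem_filter]
    constructor
    · rintro (⟨h, _⟩ | ⟨h, _⟩) <;> exact h
    · intro hi
      rcases lt_trichotomy r ‖y i‖ with h | h | h
      · exact Or.inl ⟨hi, h⟩
      · exact absurd h.symm (hnot_on i hi)
      · exact Or.inr ⟨hi, h⟩
  have hdisj : Disjoint Lg Sm := by
    rw [hLg, hSm, disjoint_filter]
    intro i _ h1 h2
    exact absurd (h1.trans h2) (lt_irrefl _)
  have hcardsum : Lg.card + Sm.card = n := by rw [← card_union_of_disjoint hdisj, hunion]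
  have hSmne : Sm.Nonempty := by
    obtain ⟨i, hi, hir⟩ := hsmall
    exact ⟨i, by rw [hSm, mem_filter]; exact ⟨hi, hir⟩⟩
  set k : ℕ := Sm.card with hk
  set l : ℕ := Lg.card with hl
  have hl1 : 1 ≤ l := card_pos.2 ⟨j₀, hj₀L⟩
  -- enumerate the large nodes
  set e : ℕ → ι := fun t => if h : t < l then ((Lg.equivFin.symm ⟨t, h⟩ : {i // i ∈ Lg}) : ι) else j₀
    with he
  have he_mem : ∀ t < l, e t ∈ Lg := by
    intro t ht
    rw [he]; dsimp only; rw [dif_pos ht]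
    exact (Lg.equivFin.symm ⟨t, ht⟩).2
  have he_inj : ∀ t₁ < l, ∀ t₂ < l, e t₁ = e t₂ → t₁ = t₂ := by
    intro t₁ h₁ t₂ h₂ h
    rw [he] at h; dsimp only at h; rw [dif_pos h₁, dif_pos h₂] at h
    have := Lg.equivFin.symm.injective (Subtype.ext h)
    simpa using this
  have he_surj : ∀ i ∈ Lg, ∃ t < l, e t = i := by
    intro i hi
    refine ⟨(Lg.equivFin ⟨i, hi⟩ : ℕ), (Lg.equivFin ⟨i, hi⟩).2, ?_⟩
    rw [he]; dsimp only; rw [dif_pos (Lg.equivFin ⟨i, hi⟩).2]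
    simp
  set x : ℕ → ℂ := fun t => y (e t) with hx
  set ρ : ℝ := r⁻¹ with hρ
  have hρ0 : 0 < ρ := inv_pos.2 hr
  have hρinv : ρ⁻¹ = r := inv_inv r
  have hxlarge : ∀ t < l, ρ⁻¹ < ‖x t‖ := by
    intro t ht
    rw [hρinv]
    have := he_mem t ht
    rw [hLg, mem_filter] at this
    exact this.2
  have hx1 : ∀ t, ‖x t‖ ≤ 1 := by
    intro t
    rw [hx]; dsimp only
    by_cases ht : t < l
    · exact hy1 _ (hLgs (he_mem t ht))
    · rw [he]; dsimp only; rw [dif_neg ht]; exact hy1 j₀ hj₀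
  have hzsmall : ∀ m ∈ Sm, ‖y m‖ < ρ⁻¹ := by
    intro m hm
    rw [hρinv]
    rw [hSm, mem_filter] at hm
    exact hm.2
  -- the uniform sub-product bound on `|ζ| = r` for `Sm ∪ e(range(t+1))`
  have hsub : ∀ t < l, ∀ ζ : ℂ, ‖ζ‖ = ρ⁻¹ →
      μ / 2 ^ n ≤ (∏ m ∈ Sm, ‖ζ - y m‖) * ∏ t' ∈ range (t + 1), ‖ζ - x t'‖ := by
    intro t ht ζ hζ
    rw [hρinv] at hζ
    set T : Finset ι := (range (t + 1)).image e with hT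
    have hTL : T ⊆ Lg := by
      intro i hi
      rw [hT, mem_image] at hi
      obtain ⟨t', ht', rfl⟩ := hi
      rw [mem_range] at ht'
      exact he_mem t' (by omega)
    have hTdisj : Disjoint Sm T := by
      refine disjoint_left.2 fun i hiS hiT => ?_
      exact disjoint_left.1 hdisj (hTL hiT) hiS
    have hprodT : ∏ t' ∈ range (t + 1), ‖ζ - x t'‖ = ∏ i ∈ T, ‖ζ - y i‖ := by
      rw [hT, prod_image]
      intro t₁ ht₁ t₂ ht₂ h
      rw [mem_coe, mem_range] at ht₁ ht₂
      exact he_inj t₁ (by omega) t₂ (by omega) h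
    rw [hprodT, ← prod_union hTdisj]
    exact hsubprod (Sm ∪ T) (union_subset hSms (hTL.trans hLgs)) ζ hζ
  -- the polynomials
  set P : ℂ[X] := smallPoly Sm y with hP
  set Q : ℂ[X] := interpQ Sm y x ρ D l with hQ
  set R : ℂ[X] := Polynomial.X ^ (D + 1) * (P * Q) with hR
  set M : ℕ := D + n + 1 with hM
  have hPdeg : P.natDegree ≤ k := by
    rw [hP, smallPoly]
    have h := Polynomial.natDegree_prod_le Sm (fun m => (Polynomial.X - Polynomial.C (y m) : ℂ[X]))
    refine h.trans (le_of_eq ?_)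
    calc ∑ m ∈ Sm, (Polynomial.X - Polynomial.C (y m) : ℂ[X]).natDegree
        = ∑ m ∈ Sm, (1 : ℕ) := sum_congr rfl fun m _ => natDegree_X_sub_C (y m)
      _ = k := by simp [hk]
  have hQdeg : Q.natDegree ≤ l - 1 := natDegree_interpQ_le hl1
  have hRdeg : R.natDegree < M := by
    rw [hR, hM]
    calc (Polynomial.X ^ (D + 1) * (P * Q)).natDegree ≤ (D + 1) + (P * Q).natDegree := by
          refine natDegree_mul_le.trans ?_
          rw [natDegree_X_pow]
      _ ≤ (D + 1) + (k + (l - 1)) := by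
          refine add_le_add le_rfl (natDegree_mul_le.trans (add_le_add hPdeg hQdeg))
      _ < D + n + 1 := by omega
  have hRlow : ∀ ν, ν < D + 1 → R.coeff ν = 0 := by
    intro ν hν
    rw [hR, coeff_X_pow_mul']
    rw [if_neg (by omega)]
  -- values of `R` at the nodes
  have hRlarge : ∀ i ∈ Lg, R.eval (y i) = 1 := by
    intro i hi
    obtain ⟨τ, hτ, rfl⟩ := he_surj i hi
    have key := eval_interpQ_mul (Sm := Sm) (z := y) (x := x) (D := D) hρ0 hzsmall hxlarge hτ
    rw [hR, eval_mul, eval_mul, eval_pow, eval_X]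
    calc y (e τ) ^ (D + 1) * (P.eval (y (e τ)) * Q.eval (y (e τ)))
        = Q.eval (x τ) * ((x τ) ^ (D + 1) * P.eval (x τ)) := by rw [hx]; dsimp only; ring
      _ = 1 := key
  have hRsmall : ∀ i ∈ Sm, R.eval (y i) = 0 := by
    intro i hi
    rw [hR, eval_mul, eval_mul, hP, eval_smallPoly]
    rw [prod_eq_zero hi (sub_self _)]
    ring
  -- the pairing identity: `∑_ν [X^ν]R · S_ν = ∑_{large} b_j`
  have hpair : ∑ ν ∈ range M, R.coeff ν * S ν = ((∑ j ∈ Lg, b j : ℝ) : ℂ) := by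
    rw [hS]; dsimp only
    rw [sum_coeff_mul_powerSum s y (fun j => (b j : ℂ)) R hRdeg, ← hunion, sum_union hdisj]
    rw [ofReal_sum]
    have h1 : ∑ j ∈ Lg, (b j : ℂ) * R.eval (y j) = ∑ j ∈ Lg, (b j : ℂ) := by
      refine sum_congr rfl fun j hj => ?_
      rw [hRlarge j hj, mul_one]
    have h2 : ∑ j ∈ Sm, (b j : ℂ) * R.eval (y j) = 0 := by
      refine sum_eq_zero fun j hj => ?_
      rw [hRsmall j hj, mul_zero]
    rw [h1, h2, add_zero]
  have hpair_le : ∑ j ∈ Lg, b j ≤ coeffNorm M R * ‖S ν₀‖ := by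
    have h := norm_sum_coeff_mul_le M R S (A := ‖S ν₀‖) (by
      intro ν hν hRν
      rw [mem_range] at hν
      refine hν₀max ν ?_
      rw [mem_Icc]
      constructor
      · by_contra hlt
        exact hRν (hRlow ν (by omega))
      · omega)
    rw [hpair, Complex.norm_real, Real.norm_of_nonneg (sum_nonneg fun j hj => hb j (hLgs hj))] at h
    exact h
  -- `‖R‖₁ ≤ 8ⁿ ρ^D / μ`
  have hμ2 : 0 < μ / 2 ^ n := by positivity
  have hRnorm : coeffNorm M R ≤ (8 : ℝ) ^ n * ρ ^ D / μ := by
    have hXn : coeffNorm M (Polynomial.X ^ (D + 1) : ℂ[X]) ≤ 1 := coeffNorm_X_pow_le M (D + 1)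
    have hPn : coeffNorm M P ≤ (2 : ℝ) ^ k := by
      rw [hP, smallPoly]
      refine (coeffNorm_prod_le M _ _).trans ?_
      calc ∏ m ∈ Sm, coeffNorm M (Polynomial.X - Polynomial.C (y m)) ≤ ∏ _m ∈ Sm, (2 : ℝ) := by
            refine prod_le_prod (fun _ _ => coeffNorm_nonneg _ _) fun m hm => ?_
            exact (coeffNorm_X_sub_C_le M _).trans (by linarith [hy1 m (hSms hm)])
        _ = (2 : ℝ) ^ k := by simp [hk]
    have hQn : coeffNorm M Q ≤ (2 : ℝ) ^ l * (ρ ^ D / (μ / 2 ^ n)) :=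
      coeffNorm_interpQ_le M hρ0 hx1 hμ2 hsub
    have h2n : (2 : ℝ) ^ k * (2 : ℝ) ^ l = (2 : ℝ) ^ n := by rw [← pow_add, show k + l = n by omega]
    calc coeffNorm M R ≤ coeffNorm M (Polynomial.X ^ (D + 1) : ℂ[X]) * coeffNorm M (P * Q) :=
          coeffNorm_mul_le M _ _
      _ ≤ 1 * (coeffNorm M P * coeffNorm M Q) :=
          mul_le_mul hXn (coeffNorm_mul_le M P Q) (coeffNorm_nonneg _ _) zero_le_one
      _ ≤ 1 * ((2 : ℝ) ^ k * ((2 : ℝ) ^ l * (ρ ^ D / (μ / 2 ^ n)))) := by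
          refine mul_le_mul_of_nonneg_left ?_ zero_le_one
          exact mul_le_mul hPn hQn (coeffNorm_nonneg _ _) (by positivity)
      _ = ((2 : ℝ) ^ k * (2 : ℝ) ^ l) * (2 : ℝ) ^ n * ρ ^ D / μ := by
          field_simp
      _ = (2 : ℝ) ^ n * (2 : ℝ) ^ n * ρ ^ D / μ := by rw [h2n]
      _ ≤ (8 : ℝ) ^ n * ρ ^ D / μ := by
          rw [div_le_div_iff_of_pos_right hμ]
          refine mul_le_mul_of_nonneg_right ?_ (by positivity)
          rw [← mul_pow]
          exact pow_le_pow_left₀ (by norm_num) (by norm_num) n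
  -- assemble
  have hbsum_ge : b j₀ ≤ ∑ j ∈ Lg, b j := single_le_sum (fun j hj => hb j (hLgs hj)) hj₀L
  have hb₀ : 0 ≤ b j₀ := hb j₀ hj₀
  have hρD : ρ ^ D * r ^ D = 1 := by rw [hρ, ← mul_pow, inv_mul_cancel₀ hr.ne', one_pow]
  have h1 : b j₀ ≤ (8 : ℝ) ^ n * ρ ^ D / μ * ‖S ν₀‖ :=
    hbsum_ge.trans (hpair_le.trans (mul_le_mul_of_nonneg_right hRnorm (norm_nonneg _)))
  calc b j₀ * (μ * r ^ D / (8 : ℝ) ^ n)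
      ≤ ((8 : ℝ) ^ n * ρ ^ D / μ * ‖S ν₀‖) * (μ * r ^ D / (8 : ℝ) ^ n) :=
        mul_le_mul_of_nonneg_right h1 (by positivity)
    _ = (ρ ^ D * r ^ D) * ‖S ν₀‖ := by field_simp
    _ = ‖S ν₀‖ := by rw [hρD, one_mul]

end MainProof

/-- **Turán's second main theorem** (maximum-modulus normalisation, nonnegative weights; the
nodes need NOT be distinct — the contour-integral form of the divided differences is insensitive
to coincidences). Let `s` be a finite index set, `z : ι → ℂ`, `b_j ≥ 0`, and `j₀ ∈ s` with
`|z_j| ≤ |z_{j₀}|` for all `j ∈ s` and `z_{j₀} ≠ 0`. Then for every `D ≥ 0` there is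
`ν ∈ [D + 1, D + n]` (`n = #s`) with
`b_{j₀} · e⁻ⁿ (n/(250(D+n)))^{n+1} · |z_{j₀}|^ν ≤ |∑_{j ∈ s} b_j z_j^ν|`.
[cite: Turan1951Carlson, Lemma III (p. 49)] -/
theorem exists_powerSum_ge_max {ι : Type*} (s : Finset ι) (z : ι → ℂ)
    (b : ι → ℝ) (hb : ∀ j ∈ s, 0 ≤ b j) {j₀ : ι} (hj₀ : j₀ ∈ s) (hmax : ∀ j ∈ s, ‖z j‖ ≤ ‖z j₀‖)
    (hz₀ : z j₀ ≠ 0) (D : ℕ) :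
    ∃ ν ∈ Icc (D + 1) (D + s.card),
      b j₀ * (Real.exp (-(s.card : ℝ)) * ((s.card : ℝ) / (250 * (D + s.card))) ^ (s.card + 1)) *
        ‖z j₀‖ ^ ν ≤ ‖∑ j ∈ s, (b j : ℂ) * z j ^ ν‖ := by
  classical
  /- ───── normalisation `|z_{j₀}| = 1` ───── -/
  set Rz : ℝ := ‖z j₀‖ with hRz
  have hRz0 : 0 < Rz := norm_pos_iff.2 hz₀
  have hRc : (Rz : ℂ) ≠ 0 := by exact_mod_cast hRz0.ne'
  set y : ι → ℂ := fun j => z j / Rz with hy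
  have hy1 : ∀ j ∈ s, ‖y j‖ ≤ 1 := by
    intro j hj
    rw [hy]; dsimp only
    rw [norm_div, Complex.norm_real, Real.norm_of_nonneg hRz0.le, div_le_one hRz0]
    exact hmax j hj
  have hy₀ : ‖y j₀‖ = 1 := by
    rw [hy]; dsimp only
    rw [norm_div, Complex.norm_real, Real.norm_of_nonneg hRz0.le, ← hRz, div_self hRz0.ne']
  have hscale : ∀ ν, ‖∑ j ∈ s, (b j : ℂ) * z j ^ ν‖ = Rz ^ ν * ‖∑ j ∈ s, (b j : ℂ) * y j ^ ν‖ := by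
    intro ν
    have : ∑ j ∈ s, (b j : ℂ) * z j ^ ν = (Rz : ℂ) ^ ν * ∑ j ∈ s, (b j : ℂ) * y j ^ ν := by
      rw [mul_sum]
      refine sum_congr rfl fun j _ => ?_
      rw [hy]; dsimp only
      rw [div_pow]
      field_simp
    rw [this, norm_mul, norm_pow, Complex.norm_real, Real.norm_of_nonneg hRz0.le]
  suffices H : ∃ ν ∈ Icc (D + 1) (D + s.card),
      b j₀ * (Real.exp (-(s.card : ℝ)) * ((s.card : ℝ) / (250 * (D + s.card))) ^ (s.card + 1)) ≤
        ‖∑ j ∈ s, (b j : ℂ) * y j ^ ν‖ by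
    obtain ⟨ν, hν, h⟩ := H
    refine ⟨ν, hν, ?_⟩
    rw [hscale ν, mul_comm (Rz ^ ν)]
    exact mul_le_mul_of_nonneg_right h (by positivity)
  /- ───── parameters and Cartan's circle ───── -/
  set n : ℕ := s.card with hn
  have hn1 : 1 ≤ n := card_pos.2 ⟨j₀, hj₀⟩
  have hnpos : (0 : ℝ) < n := by exact_mod_cast hn1
  have hD0 : (0 : ℝ) ≤ D := Nat.cast_nonneg D
  have hDn : (0 : ℝ) < D + n := by linarith
  set Hc : ℝ := (n : ℝ) / (10 * (D + n)) with hHc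
  have hHc0 : 0 < Hc := by positivity
  have hHc_le : Hc ≤ 1 / 10 := by
    rw [hHc, div_le_iff₀ (by positivity)]
    nlinarith
  have h5H : 5 * Hc ≤ 1 / 2 := by linarith
  obtain ⟨r, hrI, hgood⟩ := exists_radius_prod_ge s ⟨j₀, hj₀⟩ y hHc0 (1 - 5 * Hc)
    (L := (9 / 2) * Hc) (by linarith)
  rw [Set.mem_Icc] at hrI
  have hr_lo : 1 - 5 * Hc ≤ r := hrI.1
  have hr_lt1 : r < 1 := by linarith [hrI.2]
  have hr_pos : 0 < r := by linarith
  set μ : ℝ := ((n.factorial : ℕ) : ℝ) * (Hc / n) ^ n with hμ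
  have hμ0 : 0 < μ := by positivity
  have hcircle : ∀ w : ℂ, ‖w‖ = r → μ ≤ ∏ i ∈ s, ‖w - y i‖ := fun w hw => hgood w hw
  -- `r^m ≥ e^{−n}` for `m ≤ D + n`
  have hexp : Real.exp (-(n : ℝ)) ≤ (1 - 5 * Hc) ^ (D + n) := by
    have h1 : Real.exp (-(2 * (5 * Hc))) ≤ 1 - 5 * Hc :=
      exp_neg_two_mul_le_one_sub (by positivity) h5H
    have h2 : Real.exp (-(n : ℝ)) = (Real.exp (-(2 * (5 * Hc)))) ^ (D + n) := by
      rw [← Real.exp_nat_mul]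
      congr 1
      rw [hHc]; push_cast; field_simp; ring
    rw [h2]
    exact pow_le_pow_left₀ (Real.exp_pos _).le h1 _
  have hrpow : ∀ m : ℕ, m ≤ D + n → Real.exp (-(n : ℝ)) ≤ r ^ m := by
    intro m hm
    calc Real.exp (-(n : ℝ)) ≤ (1 - 5 * Hc) ^ (D + n) := hexp
      _ ≤ (1 - 5 * Hc) ^ m := pow_le_pow_of_le_one (by linarith) (by linarith) hm
      _ ≤ r ^ m := pow_le_pow_left₀ (by linarith) hr_lo m
  -- the maximum of `|S_ν|` over the window
  set S : ℕ → ℂ := fun ν => ∑ j ∈ s, (b j : ℂ) * y j ^ ν with hS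
  have hne : (Icc (D + 1) (D + n)).Nonempty := by rw [nonempty_Icc]; omega
  obtain ⟨ν₀, hν₀, hν₀max⟩ := exists_max_image (Icc (D + 1) (D + n)) (fun ν => ‖S ν‖) hne
  refine ⟨ν₀, hν₀, ?_⟩
  have hb₀ : 0 ≤ b j₀ := hb j₀ hj₀
  set cst : ℝ := Real.exp (-(n : ℝ)) * ((n : ℝ) / (250 * (D + n))) ^ (n + 1) with hcst
  by_cases hsmall : ∃ i ∈ s, ‖y i‖ < r
  · /- Case 2: a small node exists -/
    have hj₀r : r < ‖y j₀‖ := by rw [hy₀]; exact hr_lt1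
    have hcase := case_small (D := D) hb hy1 hj₀ hj₀r hr_pos hμ0 hcircle hsmall hν₀max
    have hc2 := targetConst_le_case2 hn1 D
    rw [← hHc] at hc2
    calc b j₀ * cst ≤ b j₀ * (Real.exp (-(n : ℝ)) * μ / (8 : ℝ) ^ n) :=
          mul_le_mul_of_nonneg_left hc2 hb₀
      _ ≤ b j₀ * (μ * r ^ D / (8 : ℝ) ^ n) := by
          refine mul_le_mul_of_nonneg_left ?_ hb₀
          rw [mul_comm (Real.exp _) μ]
          gcongr
          exact hrpow D (by omega)
      _ ≤ ‖S ν₀‖ := hcase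
  · /- Case 1: all nodes are large; first main theorem with `ρ = r` -/
    push Not at hsmall
    obtain ⟨ν, hν, h1⟩ := exists_powerSum_ge s ⟨j₀, hj₀⟩ y (fun j => (b j : ℂ)) hr_pos hsmall D
    have hbnorm : ‖∑ j ∈ s, (b j : ℂ)‖ = ∑ j ∈ s, b j := by
      rw [← ofReal_sum, Complex.norm_real, Real.norm_of_nonneg (sum_nonneg hb)]
    rw [hbnorm] at h1
    rw [mem_Icc] at hν
    have hSν : ‖S ν‖ ≤ ‖S ν₀‖ := hν₀max ν (by rw [mem_Icc]; exact hν)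
    have hbsum_ge : b j₀ ≤ ∑ j ∈ s, b j := single_le_sum hb hj₀
    have hC : (0 : ℝ) < (2 : ℝ) ^ n * ((D + n + 1).choose (n + 1) : ℝ) := by
      have : 0 < (D + n + 1).choose (n + 1) := Nat.choose_pos (by omega)
      positivity
    have h2 : Real.exp (-(n : ℝ)) * b j₀ ≤ (2 : ℝ) ^ n * ((D + n + 1).choose (n + 1) : ℝ) * ‖S ν₀‖ := by
      calc Real.exp (-(n : ℝ)) * b j₀ ≤ r ^ ν * ∑ j ∈ s, b j :=
            mul_le_mul (hrpow ν hν.2) hbsum_ge hb₀ (by positivity)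
        _ ≤ (2 : ℝ) ^ n * ((D + n + 1).choose (n + 1) : ℝ) * ‖S ν‖ := h1
        _ ≤ _ := mul_le_mul_of_nonneg_left hSν hC.le
    calc b j₀ * cst ≤ b j₀ * (Real.exp (-(n : ℝ)) / ((2 : ℝ) ^ n * ((D + n + 1).choose (n + 1) : ℝ))) :=
          mul_le_mul_of_nonneg_left (targetConst_le_case1 hn1 D) hb₀
      _ = Real.exp (-(n : ℝ)) * b j₀ / ((2 : ℝ) ^ n * ((D + n + 1).choose (n + 1) : ℝ)) := by ring
      _ ≤ ‖S ν₀‖ := by rw [div_le_iff₀ hC]; linarith [h2]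

end Literature.Analysis.Complex.PowerSum
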